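import Summits.NavierStokesRegularity.NavierStokesRegularity.Theses.TypeIIInviscidRelaxation
import Summits.NavierStokesRegularity.NavierStokesRegularity.Theorems.TypeIIInviscidRelaxationAxisymSwirlRegularSplitTightness
import Summits.NavierStokesRegularity.NavierStokesRegularity.Theorems.TypeIIInviscidRelaxationAprioriRadialInflowBoundStubMinPrincipleSublevel
import HarnessLib

/-!
# Crux `AxisymSwirlRegular` (stmt-NavierStokesRegularity-1964), line `radial_inflow_split`, piece X₂
# `AprioriRadialInflowBound` (⟨19060⟩): the piece IS the supercritical defect floor, BY NAME

`--supports stmt-NavierStokesRegularity-1964` (helper file; theorems only, no definitions, no `sorry`).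

With the assembly stub `stub_minPrinciple_sublevel` of the registered line
`Cruxes/AprioriRadialInflowBound/Lines/supercritical_defect_floor.lean` landed
(`SupercriticalDefectFloor.stub_minPrinciple_sublevel`, `inflowBound_of_sublevelDefectFloor`), the route item
`AprioriRadialInflowBound` (⟨19060⟩ = stub X₂ of ⟨1964⟩) follows from the line's research stub ALONE — the
SUPERCRITICAL DEFECT FLOOR: in the standing class there are a level `C₀`, a tube radius `δ > 0` and a
continuous integrable `g` on `[0,T)` with `u₀² + u₁² − (x₀∂₀p + x₁∂₁p) ≥ −g(t)` at every off-axis spatial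
critical point of `Φ(t,·) = x₀u₀ + x₁u₁` in `{cylRadius < δ}` with `ΔΦ ≥ 0` and `Φ ≤ −C₀ν`. Conversely the
floor is NECESSARY: an a-priori bound `Φ ≥ −Cν` on `{cylRadius < δ}` makes the sub-level set `{Φ ≤ −(C+1)ν}`
empty there, so the floor holds with `g = 0`. Hence, in kernel and by name,

* `aprioriRadialInflowBound_iff_supercriticalDefectFloor : AprioriRadialInflowBound ↔ (floor)`;
* `axisymSwirlRegular_iff_oneSidedRadialCriterion_and_supercriticalDefectFloor :
    AxisymSwirlRegular ↔ OneSidedRadialCriterion ∧ (floor)`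

(through the tree's `axisymSwirlRegular_iff_oneSidedRadialCriterion_and_aprioriRadialInflowBound`).

HONEST FRAMING: these are EQUIVALENCE certificates — the research stub carries exactly the strength of
⟨19060⟩ (no strength is lost or gained by the line); nothing is closed: the floor (a one-sided a-priori
PRESSURE statement at the strongest supercritical inflow points, where Hou's pressure-driven focusing jet
would have to make `−defect` non-integrable in time) is open, and so are ⟨19060⟩, ⟨19059⟩ (`C ≥ 2`) and
⟨1964⟩. Nothing about Navier–Stokes regularity is claimed.
-/

noncomputable section

open Literature.Analysis.FluidPDE MeasureTheory Set
open scoped Laplacian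

namespace Summit.NavierStokesRegularity.NavierStokesRegularity.Theorems

-- the problem directory repeats the summit name (`NavierStokesRegularity/NavierStokesRegularity`)
set_option linter.dupNamespace false

open Summit.NavierStokesRegularity.NavierStokesRegularity.Theses.TypeIIInviscidRelaxation

/-- **X₂ ⟸ supercritical defect floor, BY NAME.** The route item `AprioriRadialInflowBound` (⟨19060⟩)
follows from the research stub `stub_supercriticalDefectFloor` of its registered line alone, through the
landed assembly stub (`inflowBound_of_sublevelDefectFloor`). Nothing is closed: the hypothesis is open.
[new] -/
theorem aprioriRadialInflowBound_of_supercriticalDefectFloor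
    (hF : ∀ (ν T : ℝ), 0 < ν → 0 < T →
      ∀ (u : ℝ → EuclideanSpace ℝ (Fin 3) → EuclideanSpace ℝ (Fin 3)) (p : ℝ → EuclideanSpace ℝ (Fin 3) → ℝ),
      IsClassicalNSSolutionOn (Ico 0 T) ν 0 u p → IsLerayHopfOn T ν 0 (u 0) u →
      (∀ T' < T, ∃ M : ℝ, ∀ t ∈ Icc 0 T', ∀ x, ‖u t x‖ ≤ M) →
      (∀ t ∈ Ico 0 T, IsAxisymmetric (u t)) → HasRapidSpatialDecay (u 0) →
      ∃ (C₀ δ : ℝ) (g : ℝ → ℝ), 0 < δ ∧ ContinuousOn g (Ico 0 T) ∧ IntegrableOn g (Ico 0 T) ∧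
        ∀ t ∈ Ico 0 T, ∀ x : EuclideanSpace ℝ (Fin 3), cylRadius x < δ → cylRadius x ≠ 0 →
          x 0 * u t x 0 + x 1 * u t x 1 ≤ -(C₀ * ν) →
          fderiv ℝ (fun z : EuclideanSpace ℝ (Fin 3) => z 0 * u t z 0 + z 1 * u t z 1) x = 0 →
          0 ≤ (Δ (fun z : EuclideanSpace ℝ (Fin 3) => z 0 * u t z 0 + z 1 * u t z 1)) x →
          -g t ≤ (u t x 0) ^ 2 + (u t x 1) ^ 2
            - (x 0 * fderiv ℝ (p t) x (EuclideanSpace.single 0 1)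
                + x 1 * fderiv ℝ (p t) x (EuclideanSpace.single 1 1))) :
    AprioriRadialInflowBound := by
  intro ν T hν hT u p hcl hLH hbd hax hdec
  obtain ⟨C₀, δ, g, hδ, hgc, hgi, hfl⟩ := hF ν T hν hT u p hcl hLH hbd hax hdec
  exact inflowBound_of_sublevelDefectFloor (⟨hν, hT, hcl, hLH, hbd, hax⟩ : AxisymmetricL3Hyp ν T u p)
    (C₀ := C₀) hδ hgc hgi hfl

/-- **The supercritical defect floor is NECESSARY for X₂ (vacuously).** If `Φ = x₀u₀ + x₁u₁ ≥ −Cν` on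
`{cylRadius < δ} × [0,T)`, then with the level `C₀ = C + 1` the sub-level set `{Φ ≤ −C₀ν}` does not meet
the tube, so the floor holds there with `g = 0`. [new] -/
theorem supercriticalDefectFloor_of_aprioriRadialInflowBound (hB : AprioriRadialInflowBound) :
    ∀ (ν T : ℝ), 0 < ν → 0 < T →
      ∀ (u : ℝ → EuclideanSpace ℝ (Fin 3) → EuclideanSpace ℝ (Fin 3)) (p : ℝ → EuclideanSpace ℝ (Fin 3) → ℝ),
      IsClassicalNSSolutionOn (Ico 0 T) ν 0 u p → IsLerayHopfOn T ν 0 (u 0) u →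
      (∀ T' < T, ∃ M : ℝ, ∀ t ∈ Icc 0 T', ∀ x, ‖u t x‖ ≤ M) →
      (∀ t ∈ Ico 0 T, IsAxisymmetric (u t)) → HasRapidSpatialDecay (u 0) →
      ∃ (C₀ δ : ℝ) (g : ℝ → ℝ), 0 < δ ∧ ContinuousOn g (Ico 0 T) ∧ IntegrableOn g (Ico 0 T) ∧
        ∀ t ∈ Ico 0 T, ∀ x : EuclideanSpace ℝ (Fin 3), cylRadius x < δ → cylRadius x ≠ 0 →
          x 0 * u t x 0 + x 1 * u t x 1 ≤ -(C₀ * ν) →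
          fderiv ℝ (fun z : EuclideanSpace ℝ (Fin 3) => z 0 * u t z 0 + z 1 * u t z 1) x = 0 →
          0 ≤ (Δ (fun z : EuclideanSpace ℝ (Fin 3) => z 0 * u t z 0 + z 1 * u t z 1)) x →
          -g t ≤ (u t x 0) ^ 2 + (u t x 1) ^ 2
            - (x 0 * fderiv ℝ (p t) x (EuclideanSpace.single 0 1)
                + x 1 * fderiv ℝ (p t) x (EuclideanSpace.single 1 1)) := by
  intro ν T hν hT u p hcl hLH hbd hax hdec
  obtain ⟨C, δ, hδ, hΦ⟩ := hB ν T hν hT u p hcl hLH hbd hax hdec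
  refine ⟨C + 1, δ, fun _ => 0, hδ, continuousOn_const, ?_, ?_⟩
  · exact integrableOn_zero
  · intro t ht x hx _ hlev _ _
    exfalso
    have h := hΦ t ht x hx
    have : -((C + 1) * ν) < -(C * ν) := by nlinarith
    linarith

/-- **EQUIVALENCE CERTIFICATE, BY NAME: `AprioriRadialInflowBound ↔` supercritical defect floor.** The
research stub of the registered line `supercritical_defect_floor` carries exactly the strength of the route
item ⟨19060⟩ (modulo the landed assembly stub). Nothing is closed. [new] -/
theorem aprioriRadialInflowBound_iff_supercriticalDefectFloor :
    AprioriRadialInflowBound ↔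
    ∀ (ν T : ℝ), 0 < ν → 0 < T →
      ∀ (u : ℝ → EuclideanSpace ℝ (Fin 3) → EuclideanSpace ℝ (Fin 3)) (p : ℝ → EuclideanSpace ℝ (Fin 3) → ℝ),
      IsClassicalNSSolutionOn (Ico 0 T) ν 0 u p → IsLerayHopfOn T ν 0 (u 0) u →
      (∀ T' < T, ∃ M : ℝ, ∀ t ∈ Icc 0 T', ∀ x, ‖u t x‖ ≤ M) →
      (∀ t ∈ Ico 0 T, IsAxisymmetric (u t)) → HasRapidSpatialDecay (u 0) →
      ∃ (C₀ δ : ℝ) (g : ℝ → ℝ), 0 < δ ∧ ContinuousOn g (Ico 0 T) ∧ IntegrableOn g (Ico 0 T) ∧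
        ∀ t ∈ Ico 0 T, ∀ x : EuclideanSpace ℝ (Fin 3), cylRadius x < δ → cylRadius x ≠ 0 →
          x 0 * u t x 0 + x 1 * u t x 1 ≤ -(C₀ * ν) →
          fderiv ℝ (fun z : EuclideanSpace ℝ (Fin 3) => z 0 * u t z 0 + z 1 * u t z 1) x = 0 →
          0 ≤ (Δ (fun z : EuclideanSpace ℝ (Fin 3) => z 0 * u t z 0 + z 1 * u t z 1)) x →
          -g t ≤ (u t x 0) ^ 2 + (u t x 1) ^ 2
            - (x 0 * fderiv ℝ (p t) x (EuclideanSpace.single 0 1)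
                + x 1 * fderiv ℝ (p t) x (EuclideanSpace.single 1 1)) :=
  ⟨supercriticalDefectFloor_of_aprioriRadialInflowBound, aprioriRadialInflowBound_of_supercriticalDefectFloor⟩

/-- **The line's current shape for the crux ⟨1964⟩, BY NAME:
`AxisymSwirlRegular ↔ OneSidedRadialCriterion ∧` supercritical defect floor.** Through the tree's tightness
certificate `axisymSwirlRegular_iff_oneSidedRadialCriterion_and_aprioriRadialInflowBound` and the equivalence
above. Both conjuncts are open (`OneSidedRadialCriterion` for gate constants `C ≥ 2`; the floor is the research
stub of ⟨19060⟩'s line); nothing is closed. [new] -/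
theorem axisymSwirlRegular_iff_oneSidedRadialCriterion_and_supercriticalDefectFloor :
    AxisymSwirlRegular ↔ OneSidedRadialCriterion ∧
    ∀ (ν T : ℝ), 0 < ν → 0 < T →
      ∀ (u : ℝ → EuclideanSpace ℝ (Fin 3) → EuclideanSpace ℝ (Fin 3)) (p : ℝ → EuclideanSpace ℝ (Fin 3) → ℝ),
      IsClassicalNSSolutionOn (Ico 0 T) ν 0 u p → IsLerayHopfOn T ν 0 (u 0) u →
      (∀ T' < T, ∃ M : ℝ, ∀ t ∈ Icc 0 T', ∀ x, ‖u t x‖ ≤ M) →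
      (∀ t ∈ Ico 0 T, IsAxisymmetric (u t)) → HasRapidSpatialDecay (u 0) →
      ∃ (C₀ δ : ℝ) (g : ℝ → ℝ), 0 < δ ∧ ContinuousOn g (Ico 0 T) ∧ IntegrableOn g (Ico 0 T) ∧
        ∀ t ∈ Ico 0 T, ∀ x : EuclideanSpace ℝ (Fin 3), cylRadius x < δ → cylRadius x ≠ 0 →
          x 0 * u t x 0 + x 1 * u t x 1 ≤ -(C₀ * ν) →
          fderiv ℝ (fun z : EuclideanSpace ℝ (Fin 3) => z 0 * u t z 0 + z 1 * u t z 1) x = 0 →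
          0 ≤ (Δ (fun z : EuclideanSpace ℝ (Fin 3) => z 0 * u t z 0 + z 1 * u t z 1)) x →
          -g t ≤ (u t x 0) ^ 2 + (u t x 1) ^ 2
            - (x 0 * fderiv ℝ (p t) x (EuclideanSpace.single 0 1)
                + x 1 * fderiv ℝ (p t) x (EuclideanSpace.single 1 1)) := by
  rw [axisymSwirlRegular_iff_oneSidedRadialCriterion_and_aprioriRadialInflowBound,
    aprioriRadialInflowBound_iff_supercriticalDefectFloor]

/-- **Modus ponens form for the crux, BY NAME**: `AxisymSwirlRegular` from the one-sided radial inflow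
criterion ⟨19059⟩ and the supercritical defect floor (both open). [new] -/
theorem axisymSwirlRegular_of_oneSidedRadialCriterion_of_supercriticalDefectFloor
    (hX1 : OneSidedRadialCriterion)
    (hF : ∀ (ν T : ℝ), 0 < ν → 0 < T →
      ∀ (u : ℝ → EuclideanSpace ℝ (Fin 3) → EuclideanSpace ℝ (Fin 3)) (p : ℝ → EuclideanSpace ℝ (Fin 3) → ℝ),
      IsClassicalNSSolutionOn (Ico 0 T) ν 0 u p → IsLerayHopfOn T ν 0 (u 0) u →
      (∀ T' < T, ∃ M : ℝ, ∀ t ∈ Icc 0 T', ∀ x, ‖u t x‖ ≤ M) →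
      (∀ t ∈ Ico 0 T, IsAxisymmetric (u t)) → HasRapidSpatialDecay (u 0) →
      ∃ (C₀ δ : ℝ) (g : ℝ → ℝ), 0 < δ ∧ ContinuousOn g (Ico 0 T) ∧ IntegrableOn g (Ico 0 T) ∧
        ∀ t ∈ Ico 0 T, ∀ x : EuclideanSpace ℝ (Fin 3), cylRadius x < δ → cylRadius x ≠ 0 →
          x 0 * u t x 0 + x 1 * u t x 1 ≤ -(C₀ * ν) →
          fderiv ℝ (fun z : EuclideanSpace ℝ (Fin 3) => z 0 * u t z 0 + z 1 * u t z 1) x = 0 →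
          0 ≤ (Δ (fun z : EuclideanSpace ℝ (Fin 3) => z 0 * u t z 0 + z 1 * u t z 1)) x →
          -g t ≤ (u t x 0) ^ 2 + (u t x 1) ^ 2
            - (x 0 * fderiv ℝ (p t) x (EuclideanSpace.single 0 1)
                + x 1 * fderiv ℝ (p t) x (EuclideanSpace.single 1 1))) :
    AxisymSwirlRegular :=
  axisymSwirlRegular_iff_oneSidedRadialCriterion_and_aprioriRadialInflowBound.2
    ⟨hX1, aprioriRadialInflowBound_of_supercriticalDefectFloor hF⟩

/-! ### §2 (appended). The floor is needed only near the final time: germ form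

The supercritical defect floor is consumed by the minimum principle only through its time integral, and on
every early slab `[0, T₁]` (`T₁ < T`) the solution is bounded, so the sub-level set `{Φ ≤ -C₀ν} ∩ {r < δ}` is
EMPTY there once the level is raised above `δ‖u‖_∞/ν`. Hence the floor asked only on SOME final interval
`[T₁, T)` (its GERM at the blow-up time) already gives the whole-interval floor, and ⟨19060⟩ is equivalent to
the germ form as well. (Same bookkeeping as the tree's germ certificates `aprioriRadialInflowBound_iff_germ`,
`oneSidedRadialCriterion_iff_germ` of `…GeTwoGerm.lean`, now for the research stub.) -/

/-- **Germ ⇒ whole interval, per solution.** If `u` is bounded on sub-slabs and the supercritical defect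
floor holds on a final interval `[T₁,T)`, `T₁ < T` (level `C₀`, tube `δ`, floor `g` continuous and
integrable on `[T₁,T)`), then it holds on `[0,T)` with level `max C₀ (δ·max B 0/ν + 1)` (`B` a velocity bound on
`[0,T₁] × ℝ³`), the same tube, and the floor `t ↦ g (max t T₁)`: before `T₁` the raised sub-level set does
not meet the tube (`Φ ≥ -δB` there). [new; bookkeeping] -/
theorem supercriticalDefectFloor_of_germ {ν T : ℝ} (hν : 0 < ν)
    {u : ℝ → EuclideanSpace ℝ (Fin 3) → EuclideanSpace ℝ (Fin 3)} {p : ℝ → EuclideanSpace ℝ (Fin 3) → ℝ}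
    (hbd : ∀ T' < T, ∃ M : ℝ, ∀ t ∈ Icc 0 T', ∀ x, ‖u t x‖ ≤ M)
    {C₀ δ T₁ : ℝ} {g : ℝ → ℝ} (hδ : 0 < δ) (hT₁T : T₁ < T)
    (hgc : ContinuousOn g (Ico T₁ T)) (hgi : IntegrableOn g (Ico T₁ T))
    (hfl : ∀ t ∈ Ico T₁ T, ∀ x : EuclideanSpace ℝ (Fin 3), cylRadius x < δ → cylRadius x ≠ 0 →
      x 0 * u t x 0 + x 1 * u t x 1 ≤ -(C₀ * ν) →
      fderiv ℝ (fun z : EuclideanSpace ℝ (Fin 3) => z 0 * u t z 0 + z 1 * u t z 1) x = 0 →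
      0 ≤ (Δ (fun z : EuclideanSpace ℝ (Fin 3) => z 0 * u t z 0 + z 1 * u t z 1)) x →
      -g t ≤ (u t x 0) ^ 2 + (u t x 1) ^ 2
        - (x 0 * fderiv ℝ (p t) x (EuclideanSpace.single 0 1)
            + x 1 * fderiv ℝ (p t) x (EuclideanSpace.single 1 1))) :
    ∃ (C₀' δ' : ℝ) (g' : ℝ → ℝ), 0 < δ' ∧ ContinuousOn g' (Ico 0 T) ∧ IntegrableOn g' (Ico 0 T) ∧
      ∀ t ∈ Ico 0 T, ∀ x : EuclideanSpace ℝ (Fin 3), cylRadius x < δ' → cylRadius x ≠ 0 →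
        x 0 * u t x 0 + x 1 * u t x 1 ≤ -(C₀' * ν) →
        fderiv ℝ (fun z : EuclideanSpace ℝ (Fin 3) => z 0 * u t z 0 + z 1 * u t z 1) x = 0 →
        0 ≤ (Δ (fun z : EuclideanSpace ℝ (Fin 3) => z 0 * u t z 0 + z 1 * u t z 1)) x →
        -g' t ≤ (u t x 0) ^ 2 + (u t x 1) ^ 2
          - (x 0 * fderiv ℝ (p t) x (EuclideanSpace.single 0 1)
              + x 1 * fderiv ℝ (p t) x (EuclideanSpace.single 1 1)) := by
  obtain ⟨B, hB⟩ := hbd T₁ hT₁T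
  set g' : ℝ → ℝ := fun t => g (max t T₁) with hg'_def
  -- the extended floor is continuous and integrable on `[0,T)`
  have hmaps : MapsTo (fun t : ℝ => max t T₁) (Ico 0 T) (Ico T₁ T) :=
    fun t ht => ⟨le_max_right _ _, max_lt ht.2 hT₁T⟩
  have hg'c : ContinuousOn g' (Ico 0 T) :=
    hgc.comp (continuous_id.max continuous_const).continuousOn hmaps
  have hg'1 : IntegrableOn g' (Icc 0 T₁) := by
    have hconst : IntegrableOn (fun _ : ℝ => g T₁) (Icc 0 T₁) :=
      continuousOn_const.integrableOn_compact isCompact_Icc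
    refine hconst.congr_fun (fun t ht => ?_) measurableSet_Icc
    simp only [hg'_def, max_eq_right ht.2]
  have hg'2 : IntegrableOn g' (Ico T₁ T) := by
    refine hgi.congr_fun (fun t ht => ?_) measurableSet_Ico
    simp only [hg'_def, max_eq_left ht.1]
  have hg'i : IntegrableOn g' (Ico 0 T) :=
    (hg'1.union hg'2).mono_set fun t ht => by
      by_cases h : t ≤ T₁
      · exact Or.inl ⟨ht.1, h⟩
      · exact Or.inr ⟨le_of_not_ge h, ht.2⟩
  refine ⟨max C₀ (δ * max B 0 / ν + 1), δ, g', hδ, hg'c, hg'i, ?_⟩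
  intro t ht x hr h0 hlev hgrad hlap
  by_cases htT₁ : t < T₁
  · -- early slab: the raised sub-level set does not meet the tube
    exfalso
    have hux : ‖u t x‖ ≤ max B 0 := (hB t ⟨ht.1, htT₁.le⟩ x).trans (le_max_left _ _)
    have hΦ : -(δ * max B 0) ≤ x 0 * u t x 0 + x 1 * u t x 1 :=
      radialMomentum_ge_neg_mul_of_norm_le hr.le hux
    have hlev' : x 0 * u t x 0 + x 1 * u t x 1 ≤ -((δ * max B 0 / ν + 1) * ν) := by
      have h1 : (δ * max B 0 / ν + 1) * ν ≤ max C₀ (δ * max B 0 / ν + 1) * ν :=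
        mul_le_mul_of_nonneg_right (le_max_right _ _) hν.le
      linarith
    have e : (δ * max B 0 / ν + 1) * ν = δ * max B 0 + ν := by
      field_simp
    rw [e] at hlev'
    linarith
  · -- final interval: the germ floor, at the lower level `C₀`
    push Not at htT₁
    have ht' : t ∈ Ico T₁ T := ⟨htT₁, ht.2⟩
    have hlevC : x 0 * u t x 0 + x 1 * u t x 1 ≤ -(C₀ * ν) := by
      have h1 : C₀ * ν ≤ max C₀ (δ * max B 0 / ν + 1) * ν :=
        mul_le_mul_of_nonneg_right (le_max_left _ _) hν.le
      linarith
    have hg't : g' t = g t := by simp only [hg'_def, max_eq_left htT₁]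
    rw [hg't]
    exact hfl t ht' x hr h0 hlevC hgrad hlap

/-- **EQUIVALENCE CERTIFICATE, BY NAME: `AprioriRadialInflowBound ↔` the GERM of the supercritical defect
floor at the final time** (floor asked only on some `[T₁, T)`, `0 ≤ T₁ < T`). Nothing is closed. [new] -/
theorem aprioriRadialInflowBound_iff_supercriticalDefectFloorGerm :
    AprioriRadialInflowBound ↔
    ∀ (ν T : ℝ), 0 < ν → 0 < T →
      ∀ (u : ℝ → EuclideanSpace ℝ (Fin 3) → EuclideanSpace ℝ (Fin 3)) (p : ℝ → EuclideanSpace ℝ (Fin 3) → ℝ),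
      IsClassicalNSSolutionOn (Ico 0 T) ν 0 u p → IsLerayHopfOn T ν 0 (u 0) u →
      (∀ T' < T, ∃ M : ℝ, ∀ t ∈ Icc 0 T', ∀ x, ‖u t x‖ ≤ M) →
      (∀ t ∈ Ico 0 T, IsAxisymmetric (u t)) → HasRapidSpatialDecay (u 0) →
      ∃ (C₀ δ T₁ : ℝ) (g : ℝ → ℝ), 0 < δ ∧ 0 ≤ T₁ ∧ T₁ < T ∧
        ContinuousOn g (Ico T₁ T) ∧ IntegrableOn g (Ico T₁ T) ∧
        ∀ t ∈ Ico T₁ T, ∀ x : EuclideanSpace ℝ (Fin 3), cylRadius x < δ → cylRadius x ≠ 0 →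
          x 0 * u t x 0 + x 1 * u t x 1 ≤ -(C₀ * ν) →
          fderiv ℝ (fun z : EuclideanSpace ℝ (Fin 3) => z 0 * u t z 0 + z 1 * u t z 1) x = 0 →
          0 ≤ (Δ (fun z : EuclideanSpace ℝ (Fin 3) => z 0 * u t z 0 + z 1 * u t z 1)) x →
          -g t ≤ (u t x 0) ^ 2 + (u t x 1) ^ 2
            - (x 0 * fderiv ℝ (p t) x (EuclideanSpace.single 0 1)
                + x 1 * fderiv ℝ (p t) x (EuclideanSpace.single 1 1)) := by
  constructor
  · intro hB ν T hν hT u p hcl hLH hbd hax hdec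
    obtain ⟨C₀, δ, g, hδ, hgc, hgi, hfl⟩ :=
      supercriticalDefectFloor_of_aprioriRadialInflowBound hB ν T hν hT u p hcl hLH hbd hax hdec
    exact ⟨C₀, δ, 0, g, hδ, le_rfl, hT, hgc, hgi, hfl⟩
  · intro hG ν T hν hT u p hcl hLH hbd hax hdec
    obtain ⟨C₀, δ, T₁, g, hδ, -, hT₁T, hgc, hgi, hfl⟩ := hG ν T hν hT u p hcl hLH hbd hax hdec
    obtain ⟨C₀', δ', g', hδ', hg'c, hg'i, hfl'⟩ :=
      supercriticalDefectFloor_of_germ (p := p) hν hbd hδ hT₁T hgc hgi hfl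
    exact inflowBound_of_sublevelDefectFloor (⟨hν, hT, hcl, hLH, hbd, hax⟩ : AxisymmetricL3Hyp ν T u p)
      (C₀ := C₀') hδ' hg'c hg'i hfl'

/-- **The crux ⟨1964⟩, BY NAME: `AxisymSwirlRegular ↔ OneSidedRadialCriterion ∧` (germ of the supercritical
defect floor at the final time).** Nothing is closed. [new] -/
theorem axisymSwirlRegular_iff_oneSidedRadialCriterion_and_supercriticalDefectFloorGerm :
    AxisymSwirlRegular ↔ OneSidedRadialCriterion ∧
    ∀ (ν T : ℝ), 0 < ν → 0 < T →
      ∀ (u : ℝ → EuclideanSpace ℝ (Fin 3) → EuclideanSpace ℝ (Fin 3)) (p : ℝ → EuclideanSpace ℝ (Fin 3) → ℝ),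
      IsClassicalNSSolutionOn (Ico 0 T) ν 0 u p → IsLerayHopfOn T ν 0 (u 0) u →
      (∀ T' < T, ∃ M : ℝ, ∀ t ∈ Icc 0 T', ∀ x, ‖u t x‖ ≤ M) →
      (∀ t ∈ Ico 0 T, IsAxisymmetric (u t)) → HasRapidSpatialDecay (u 0) →
      ∃ (C₀ δ T₁ : ℝ) (g : ℝ → ℝ), 0 < δ ∧ 0 ≤ T₁ ∧ T₁ < T ∧
        ContinuousOn g (Ico T₁ T) ∧ IntegrableOn g (Ico T₁ T) ∧
        ∀ t ∈ Ico T₁ T, ∀ x : EuclideanSpace ℝ (Fin 3), cylRadius x < δ → cylRadius x ≠ 0 →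
          x 0 * u t x 0 + x 1 * u t x 1 ≤ -(C₀ * ν) →
          fderiv ℝ (fun z : EuclideanSpace ℝ (Fin 3) => z 0 * u t z 0 + z 1 * u t z 1) x = 0 →
          0 ≤ (Δ (fun z : EuclideanSpace ℝ (Fin 3) => z 0 * u t z 0 + z 1 * u t z 1)) x →
          -g t ≤ (u t x 0) ^ 2 + (u t x 1) ^ 2
            - (x 0 * fderiv ℝ (p t) x (EuclideanSpace.single 0 1)
                + x 1 * fderiv ℝ (p t) x (EuclideanSpace.single 1 1)) := by
  rw [axisymSwirlRegular_iff_oneSidedRadialCriterion_and_aprioriRadialInflowBound,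
    aprioriRadialInflowBound_iff_supercriticalDefectFloorGerm]

end Summit.NavierStokesRegularity.NavierStokesRegularity.Theorems

end
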